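import Summits.Ventures.QEC.Census.CertChunks
import Summits.Ventures.QEC.Census.BB.BB72.Cert
import HarnessLib

/-!
# `BB72` — KERNEL-tier lower-bound replay, side Z, leaf file 1/10 (emitted by qec-search-7)

Bruteforce replay (CERT-FORMAT v1 §5.1, lemma L3) of the certificate `7e943c5a566adc43`: every Z-type operator of weight
`1 … 5` has nonzero syndrome (rows `cert.HX`) or is allow-listed (allow-list []). This file holds
9 packed chunk evaluations (`chunk1R`/`chunk2R` of `Census/CertChunks.lean` over `posList 72 cert.HX`), total
1548629 scan end points, each closed by `decide +kernel` — tier KERNEL (CERTIFIED): axioms ⊆ {propext, Classical.choice,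
Quot.sound}. Assembled in `BB/BB72/KernelZ.lean`. Do not edit; re-emit (HOME/census/search-7/emit_kernel.py).
-/

namespace Summit.Ventures.QEC.Census.BB72

/-- Level-2 chunks `(0, j)`, `0 ≤ j < 3`, side Z of `BB72` (164499 end points): pass. -/
theorem kZ2_0_0 : chunk2R (leafTest []) (posList 72 cert.HX) 3 0 0 3 = true := by decide +kernel

/-- Level-2 chunks `(0, j)`, `3 ≤ j < 7`, side Z of `BB72` (187727 end points): pass. -/
theorem kZ2_0_3 : chunk2R (leafTest []) (posList 72 cert.HX) 3 0 3 4 = true := by decide +kernel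

/-- Level-2 chunks `(0, j)`, `7 ≤ j < 12`, side Z of `BB72` (189715 end points): pass. -/
theorem kZ2_0_7 : chunk2R (leafTest []) (posList 72 cert.HX) 3 0 7 5 = true := by decide +kernel

/-- Level-2 chunks `(0, j)`, `12 ≤ j < 19`, side Z of `BB72` (195202 end points): pass. -/
theorem kZ2_0_12 : chunk2R (leafTest []) (posList 72 cert.HX) 3 0 12 7 = true := by decide +kernel

/-- Level-2 chunks `(0, j)`, `19 ≤ j < 31`, side Z of `BB72` (192113 end points): pass. -/
theorem kZ2_0_19 : chunk2R (leafTest []) (posList 72 cert.HX) 3 0 19 12 = true := by decide +kernel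

/-- Level-2 chunks `(0, j)`, `31 ≤ j < 71`, side Z of `BB72` (102090 end points): pass. -/
theorem kZ2_0_31 : chunk2R (leafTest []) (posList 72 cert.HX) 3 0 31 40 = true := by decide +kernel

/-- Level-2 chunks `(1, j)`, `0 ≤ j < 3`, side Z of `BB72` (157457 end points): pass. -/
theorem kZ2_1_0 : chunk2R (leafTest []) (posList 72 cert.HX) 3 1 0 3 = true := by decide +kernel

/-- Level-2 chunks `(1, j)`, `3 ≤ j < 7`, side Z of `BB72` (179271 end points): pass. -/
theorem kZ2_1_3 : chunk2R (leafTest []) (posList 72 cert.HX) 3 1 3 4 = true := by decide +kernel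

/-- Level-2 chunks `(1, j)`, `7 ≤ j < 12`, side Z of `BB72` (180555 end points): pass. -/
theorem kZ2_1_7 : chunk2R (leafTest []) (posList 72 cert.HX) 3 1 7 5 = true := by decide +kernel

end Summit.Ventures.QEC.Census.BB72
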